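import Literature.AlgebraicGeometry.Resolution.CompletionFiniteAlgebra
import Literature.AlgebraicGeometry.Resolution.OneDimAnalyticallyUnramified
import Literature.AlgebraicGeometry.Resolution.RegularLocalRingsFlatDescent
import Literature.AlgebraicGeometry.Resolution.RegularLocalRingsNormal
import Mathlib.RingTheory.Ideal.MinimalPrime.Localization
import HarnessLib

/-!
# `TeissierResolve` — support lemmas I: regular analytic branches force a regular normalisation

Support lemmas (pure algebra) for the crux `stmt-ResolutionOfSingularities-17086`
(`Summit.ResolutionOfSingularities.ResolutionOfSingularities.Theses.TeissierJung.TeissierResolve`).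
The predicate `TF` of the crux sees a finite cover `X'` of a regular variety only through the
ANALYTIC BRANCHES `𝒪̂_{X',x} ⧸ P` (`P` a minimal prime of the completed local ring) at closed
points. The sub-case in which every branch is presented with `g = 0` equations — every branch a
regular local ring `k⟦x₁, …, x_d⟧` — is settled by classical algebra: such an `X'` is resolved by
its normalisation. This file proves the local algebra; the scheme-level assembly follows in
`TeissierJungTeissierResolveRegularBranches*.lean`.

**Theorem** (`isRegularLocalRing_localization_of_branches_regular`). Let `R` be a Noetherian
local domain, `C ⊇ R` a domain, module-finite and birational over `R` (every `c ∈ C` has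
`s • c ∈ R` for some `s ≠ 0`), whose completed local rings `(C_𝔫)^` at maximal ideals are
domains (analytic irreducibility of normal points, Zariski). If every analytic branch `R̂ ⧸ P` of
`R` is a regular local ring, then every `C_𝔫` is a regular local ring.

*Proof.* `C ⊗_R R̂ ≅ Π_𝔫 (C_𝔫)^` (Matsumura 8.7 + 8.15, the tree's `Stacks07N9_local`). The
composite `ψ : R̂ → (C_𝔫)^` is integral and birational with regular denominators from `R ∖ 0`,
so its kernel `P_𝔫` is a MINIMAL prime of `R̂` (`comap_mem_minimalPrimes_of_birational`). Hence
`R̂ ⧸ P_𝔫` is regular, so an integrally closed domain, and the injective integral birational map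
`R̂ ⧸ P_𝔫 → (C_𝔫)^` into a domain is bijective (`bijective_of_isIntegrallyClosed_of_birational`).
So `(C_𝔫)^` is regular, and regularity descends along the flat local `C_𝔫 → (C_𝔫)^`
(Matsumura 23.7 (i), the tree's `IsRegularLocalRing.of_flat_of_isLocalHom`).

Sources: Zariski–Samuel, *Commutative Algebra* II, VIII §13; Nagata, *Local Rings*, (37.5)–(37.8);
Matsumura, *Commutative Ring Theory*, Thms. 8.7, 8.15, 23.7 [Matsumura1987]; Stacks 07N9, 0C23.
Everything here is [folklore]; no definitions, no named facts.
-/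


noncomputable section

set_option linter.dupNamespace false -- mandated namespace of this single-conjunct summit

open IsLocalRing TensorProduct
open Literature.AlgebraicGeometry.Resolution

namespace Summit.ResolutionOfSingularities.ResolutionOfSingularities.Theorems.TeissierResolve.RegularBranches

universe u

/-! ## Minimal primes -/

section MinimalPrimes

variable {A B : Type*} [CommRing A] [CommRing B]

/-- In a minimal prime `Q`, every element is nilpotent in `B_Q`: for `x ∈ Q` there are `y ∉ Q`
and `n` with `y · xⁿ = 0`. [folklore] -/
theorem exists_mul_pow_eq_zero_of_mem_minimalPrimes {Q : Ideal B} (hQ : Q ∈ minimalPrimes B)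
    {x : B} (hx : x ∈ Q) : ∃ y ∉ Q, ∃ n : ℕ, y * x ^ n = 0 := by
  haveI hQp : Q.IsPrime := hQ.1.1
  -- the image of `Q` in `B_Q` is contained in the nilradical (the unique prime of `B_Q`)
  have hle : Q.map (algebraMap B (Localization.AtPrime Q)) ≤ (⊥ : Ideal _).radical := by
    rw [Ideal.radical_eq_sInf, le_sInf_iff]
    rintro q ⟨-, hq⟩
    obtain ⟨h₁, h₂⟩ := ((IsLocalization.AtPrime.orderIsoOfPrime _ Q) ⟨q, hq⟩).2
    rw [Ideal.map_le_iff_le_comap]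
    exact hQ.2 ⟨h₁, bot_le⟩ h₂
  obtain ⟨n, hn⟩ := hle (Ideal.mem_map_of_mem _ hx)
  rw [Ideal.mem_bot, ← map_pow, IsLocalization.map_eq_zero_iff Q.primeCompl] at hn
  obtain ⟨⟨y, hy⟩, hyn⟩ := hn
  exact ⟨y, hy, n, hyn⟩

/-- **Minimal primes contract to minimal primes along injective birational maps with regular
denominators.** Let `φ : A → B` be injective and `S ⊆ A` a set of elements whose images are
non-zero-divisors of `B`, such that every `b ∈ B` satisfies `φ(s) · b = φ(a)` for some `s ∈ S`,
`a ∈ A` ("`B` is birational to `A` with denominators in `S`"). Then the contraction of a minimal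
prime of `B` is a minimal prime of `A`. (When `S⁻¹A ≅ S⁻¹B` this is the usual correspondence of
minimal primes through the common total ring of fractions; the proof below is elementary.)
[folklore] -/
theorem comap_mem_minimalPrimes_of_birational (φ : A →+* B) (hφ : Function.Injective φ)
    (S : Set A) (hreg : ∀ s ∈ S, φ s ∈ nonZeroDivisors B)
    (hbir : ∀ b : B, ∃ s ∈ S, ∃ a : A, φ s * b = φ a)
    {Q : Ideal B} (hQ : Q ∈ minimalPrimes B) : Q.comap φ ∈ minimalPrimes A := by
  haveI hQp : Q.IsPrime := hQ.1.1
  obtain ⟨P', hP'min, hP'le⟩ :=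
    Ideal.exists_minimalPrimes_le (I := (⊥ : Ideal A)) (J := Q.comap φ) bot_le
  suffices h : Q.comap φ ≤ P' by rwa [le_antisymm h hP'le]
  haveI hP'p : P'.IsPrime := hP'min.1.1
  intro a ha
  rw [Ideal.mem_comap] at ha
  obtain ⟨y, hyQ, n, hy⟩ := exists_mul_pow_eq_zero_of_mem_minimalPrimes hQ ha
  obtain ⟨s, hsS, a₁, hsa⟩ := hbir y
  have h0 : φ (a₁ * a ^ n) = 0 := by
    rw [map_mul, map_pow, ← hsa, mul_assoc, hy, mul_zero]
  have hmem : a₁ * a ^ n ∈ P' := by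
    rw [hφ (h0.trans (map_zero φ).symm)]
    exact P'.zero_mem
  rcases hP'p.mem_or_mem hmem with h1 | h2
  · exfalso
    have h3 : φ s * y ∈ Q := hsa ▸ Ideal.mem_comap.mp (hP'le h1)
    rcases hQp.mem_or_mem h3 with h4 | h4
    · exact notMem_nonZeroDivisors_of_mem_mem_minimalPrimes h4 hQ (hreg s hsS)
    · exact hyQ h4
  · exact hP'p.mem_of_pow_mem n h2

/-- In a product of rings, the kernel of the projection onto a factor which is a domain is a
minimal prime (it is prime, and any prime inside it contains `1 − e` for the corresponding
idempotent `e`, hence the whole kernel). [folklore] -/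
theorem ker_evalRingHom_mem_minimalPrimes {ι : Type*} [DecidableEq ι] (D : ι → Type*)
    [∀ i, CommRing (D i)] (j : ι) [IsDomain (D j)] :
    RingHom.ker (Pi.evalRingHom D j) ∈ minimalPrimes (∀ i, D i) := by
  have hprime : (RingHom.ker (Pi.evalRingHom D j)).IsPrime := RingHom.ker_isPrime _
  refine ⟨⟨hprime, bot_le⟩, fun q hq hle => ?_⟩
  haveI := hq.1
  intro b hb
  have hb0 : b j = 0 := hb
  set e : ∀ i, D i := Pi.single j 1 with he_def
  have he : e ∉ q := fun h => by
    have : e ∈ RingHom.ker (Pi.evalRingHom D j) := hle h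
    simp [RingHom.mem_ker, he_def] at this
  have h1 : e * (1 - e) = 0 := by
    ext i; by_cases hi : i = j
    · subst hi; simp [he_def]
    · simp [he_def, hi]
  have h2 : 1 - e ∈ q := (hq.1.mem_or_mem (h1 ▸ q.zero_mem : e * (1 - e) ∈ q)).resolve_left he
  have h3 : b = b * (1 - e) := by
    ext i; by_cases hi : i = j
    · subst hi; simp [he_def, hb0]
    · simp [he_def, hi]
  exact h3 ▸ q.mul_mem_left b h2

end MinimalPrimes

/-! ## Integral birational extensions of an integrally closed domain are trivial -/

section Birational

/-- **An injective, integral, birational ring map from an integrally closed domain into a domain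
is bijective**: if every `d ∈ D` is integral over `A₀` and satisfies `ι(s) · d = ι(a)` with
`ι(s) ≠ 0`, then `a/s ∈ Frac A₀` is integral over `A₀` (clear denominators, the tree's
`exists_homogeneous_rel_of_isIntegral` / `isIntegral_div_of_homogeneous_rel`), hence in `A₀`,
and `d = ι(a/s)`. [folklore] -/
theorem bijective_of_isIntegrallyClosed_of_birational {A₀ D : Type*} [CommRing A₀] [IsDomain A₀]
    [IsIntegrallyClosed A₀] [CommRing D] [IsDomain D] (ι : A₀ →+* D)
    (hι : Function.Injective ι) (hint : ∀ d : D, ι.IsIntegralElem d)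
    (hbir : ∀ d : D, ∃ s a : A₀, ι s ≠ 0 ∧ ι s * d = ι a) : Function.Bijective ι := by
  refine ⟨hι, fun d => ?_⟩
  obtain ⟨s, a, hs, hsd⟩ := hbir d
  letI : Algebra A₀ D := ι.toAlgebra
  have hinjK : Function.Injective (algebraMap A₀ D) := hι
  have hb : IsIntegral A₀ d := hint d
  have hrel : d * algebraMap A₀ D s = algebraMap A₀ D a := by
    rw [mul_comm]; exact hsd
  obtain ⟨n, c, hc⟩ := exists_homogeneous_rel_of_isIntegral hinjK hb hrel
  -- `a / s ∈ Frac A₀` is integral, hence comes from `A₀`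
  set K := FractionRing A₀
  have hs0 : s ≠ 0 := fun h => hs (by rw [h, map_zero])
  have hsK : algebraMap A₀ K s ≠ 0 :=
    fun h => hs0 (IsFractionRing.injective A₀ K (by rw [h, map_zero]))
  have hint' : IsIntegral A₀ (algebraMap A₀ K a / algebraMap A₀ K s) :=
    isIntegral_div_of_homogeneous_rel hsK hc
  obtain ⟨y, hy⟩ := IsIntegrallyClosed.isIntegral_iff.mp hint'
  have hya : y * s = a :=
    IsFractionRing.injective A₀ K (by rw [map_mul, hy, div_mul_cancel₀ _ hsK])
  have h1 : ι s * ι y = ι s * d := by rw [← map_mul, mul_comm, hya, hsd]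
  exact ⟨y, mul_left_cancel₀ hs h1.symm ▸ rfl⟩

end Birational

/-! ## The finite birational algebra `C` over the local domain `R`, completed -/

section Core

variable (R : Type u) [CommRing R] [IsNoetherianRing R] [IsLocalRing R]
variable (C : Type u) [CommRing C] [Algebra R C] [Module.Finite R C]

local notation "R̂" => AdicCompletion (maximalIdeal R) R

/-- `Cpl[n] = (C_𝔫)^`, the completed local ring of `C` at the maximal ideal `n`. -/
local notation "Cpl[" n "]" =>
  AdicCompletion (maximalIdeal (Localization.AtPrime (MaximalSpectrum.asIdeal n)))
    (Localization.AtPrime (MaximalSpectrum.asIdeal n))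

/-- `ψΠ : R̂ → C ⊗_R R̂ ≅ Π_𝔫 (C_𝔫)^`. -/
local notation "ψΠ" =>
  (RingHom.comp (RingEquiv.toRingHom (AlgEquiv.toRingEquiv (Stacks07N9_local R C)))
    (AlgHom.toRingHom (Algebra.TensorProduct.includeRight (R := R) (A := C)
      (B := AdicCompletion (maximalIdeal R) R))))

/-- `ψ[n] : R̂ → (C_𝔫)^`, the `n`-component of `ψΠ`. -/
local notation "ψ[" n "]" => (RingHom.comp (Pi.evalRingHom _ n) ψΠ)

variable {R C}

/-- Unfolding `ψΠ`. [folklore] -/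
theorem psiPi_apply (r : R̂) :
    ψΠ r = Stacks07N9_local R C (Algebra.TensorProduct.includeRight r) := rfl

/-- `ψΠ` on the image of `s ∈ R`: the tuple of the images of `s` in the `(C_𝔫)^`. [folklore] -/
theorem psiPi_of (s : R) (n : MaximalSpectrum C) :
    ψΠ (algebraMap R R̂ s) n =
      AdicCompletion.of _ _ (algebraMap C (Localization.AtPrime n.asIdeal) (algebraMap R C s)) := by
  rw [psiPi_apply, AlgHom.commutes, Algebra.TensorProduct.algebraMap_apply]
  exact Stacks07N9_local_tmul_one R C (algebraMap R C s) n

omit [IsLocalRing R] in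
/-- For `s ≠ 0` in `R`, the image of `s` in each `(C_𝔫)^` is non-zero (`R → C → C_𝔫 → (C_𝔫)^`
is injective). [folklore] -/
theorem of_algebraMap_ne_zero [IsDomain C] (hinj : Function.Injective (algebraMap R C)) {s : R}
    (hs : s ≠ 0) (n : MaximalSpectrum C) :
    AdicCompletion.of _ _ (algebraMap C (Localization.AtPrime n.asIdeal) (algebraMap R C s)) ≠
      (0 : Cpl[n]) := by
  haveI := n.isMaximal
  haveI : IsNoetherianRing C := isNoetherian_of_tower R inferInstance
  intro h
  rw [← map_zero (AdicCompletion.of (maximalIdeal (Localization.AtPrime n.asIdeal))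
    (Localization.AtPrime n.asIdeal))] at h
  have h1 := AdicCompletion.of_injective _ _ h
  rw [← map_zero (algebraMap C (Localization.AtPrime n.asIdeal))] at h1
  have h2 := IsLocalization.injective (Localization.AtPrime n.asIdeal)
    (Ideal.primeCompl_le_nonZeroDivisors n.asIdeal) h1
  exact hs (hinj (h2.trans (map_zero _).symm))

/-- `ψΠ(s)` is a non-zero-divisor of `Π (C_𝔫)^` when `s ≠ 0` and all `(C_𝔫)^` are domains.
[folklore] -/
theorem psiPi_of_mem_nonZeroDivisors [IsDomain C] (hinj : Function.Injective (algebraMap R C))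
    (hdom : ∀ n : MaximalSpectrum C, IsDomain Cpl[n]) {s : R} (hs : s ≠ 0) :
    ψΠ (algebraMap R R̂ s) ∈ nonZeroDivisors (∀ n : MaximalSpectrum C, Cpl[n]) := by
  rw [mem_nonZeroDivisors_iff_right]
  intro b hb; funext n
  have h := congrFun hb n
  rw [Pi.mul_apply, psiPi_of, Pi.zero_apply] at h
  haveI := hdom n
  exact (mul_eq_zero.mp h).resolve_right (of_algebraMap_ne_zero hinj hs n)

omit [IsNoetherianRing R] [Module.Finite R C] in
/-- Birationality survives completion: every `t ∈ C ⊗_R R̂` has `s · t ∈ R̂` for some nonzero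
`s ∈ R`. [folklore] -/
theorem exists_smul_mem_range_includeRight [IsDomain R]
    (hbir : ∀ c : C, ∃ s : R, s ≠ 0 ∧ ∃ a : R, s • c = algebraMap R C a)
    (t : C ⊗[R] R̂) : ∃ s : R, s ≠ 0 ∧ ∃ r : R̂,
      algebraMap R (C ⊗[R] R̂) s * t = Algebra.TensorProduct.includeRight r := by
  induction t using TensorProduct.induction_on with
  | zero => exact ⟨1, one_ne_zero, 0, by simp⟩
  | tmul c x =>
    obtain ⟨s, hs, a, ha⟩ := hbir c
    refine ⟨s, hs, a • x, ?_⟩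
    rw [map_smul, Algebra.TensorProduct.includeRight_apply, TensorProduct.smul_tmul',
      ← Algebra.algebraMap_eq_smul_one, Algebra.TensorProduct.algebraMap_apply,
      Algebra.TensorProduct.tmul_mul_tmul, one_mul, ← Algebra.smul_def, ha]
  | add t₁ t₂ h₁ h₂ =>
    obtain ⟨s₁, hs₁, r₁, hr₁⟩ := h₁
    obtain ⟨s₂, hs₂, r₂, hr₂⟩ := h₂
    refine ⟨s₁ * s₂, mul_ne_zero hs₁ hs₂, s₂ • r₁ + s₁ • r₂, ?_⟩
    have e1 : algebraMap R (C ⊗[R] R̂) (s₁ * s₂) * t₁ =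
        algebraMap R (C ⊗[R] R̂) s₂ * (algebraMap R (C ⊗[R] R̂) s₁ * t₁) := by
      rw [map_mul]; ring
    have e2 : algebraMap R (C ⊗[R] R̂) (s₁ * s₂) * t₂ =
        algebraMap R (C ⊗[R] R̂) s₁ * (algebraMap R (C ⊗[R] R̂) s₂ * t₂) := by
      rw [map_mul]; ring
    rw [mul_add, e1, e2, hr₁, hr₂, map_add, map_smul, map_smul, Algebra.smul_def, Algebra.smul_def]

/-- Birationality of `ψΠ`: every element of `Π (C_𝔫)^` is `ψΠ(r) / ψΠ(s)` with `s ≠ 0` in `R`.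
[folklore] -/
theorem psiPi_birational [IsDomain R]
    (hbir : ∀ c : C, ∃ s : R, s ≠ 0 ∧ ∃ a : R, s • c = algebraMap R C a)
    (b : ∀ n : MaximalSpectrum C, Cpl[n]) :
    ∃ s : R, s ≠ 0 ∧ ∃ r : R̂, ψΠ (algebraMap R R̂ s) * b = ψΠ r := by
  obtain ⟨t, rfl⟩ := (Stacks07N9_local R C).surjective b
  obtain ⟨s, hs, r, hr⟩ := exists_smul_mem_range_includeRight hbir t
  refine ⟨s, hs, r, ?_⟩
  rw [psiPi_apply, psiPi_apply, AlgHom.commutes, ← map_mul, hr]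

/-- `ψΠ` is injective (`R̂` is flat over `R` and `R → C` is injective). [folklore] -/
theorem psiPi_injective (hinj : Function.Injective (algebraMap R C)) :
    Function.Injective ψΠ := by
  intro r₁ r₂ h
  rw [psiPi_apply, psiPi_apply] at h
  exact Algebra.TensorProduct.includeRight_injective hinj ((Stacks07N9_local R C).injective h)

omit [IsNoetherianRing R] in
/-- Every element of `C ⊗_R R̂` is integral over `R̂` (through `includeRight`). [folklore] -/
theorem isIntegralElem_includeRight (t : C ⊗[R] R̂) :
    (Algebra.TensorProduct.includeRight (R := R) (A := C) (B := R̂)).toRingHom.IsIntegralElem t := by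
  set f := (Algebra.TensorProduct.includeRight (R := R) (A := C) (B := R̂)).toRingHom with hf
  have hfx : ∀ x : R̂, f x = 1 ⊗ₜ[R] x := fun x => rfl
  induction t using TensorProduct.induction_on with
  | zero => simpa using f.isIntegralElem_map (x := 0)
  | tmul c x =>
    have h1 : c ⊗ₜ[R] x = (c ⊗ₜ[R] (1 : R̂)) * f x := by
      rw [hfx, Algebra.TensorProduct.tmul_mul_tmul, mul_one, one_mul]
    rw [h1]
    refine RingHom.IsIntegralElem.mul _ ?_ f.isIntegralElem_map
    -- `c ⊗ 1` is integral over `R`, hence over `R̂`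
    have hc : IsIntegral R (c ⊗ₜ[R] (1 : R̂)) :=
      (Algebra.IsIntegral.isIntegral (R := R) c).map
        (Algebra.TensorProduct.includeLeft (R := R) (S := R) (A := C) (B := R̂))
    obtain ⟨p, hp, hpc⟩ := hc
    refine ⟨p.map (algebraMap R R̂), hp.map _, ?_⟩
    rw [Polynomial.eval₂_map]
    have : f.comp (algebraMap R R̂) = algebraMap R (C ⊗[R] R̂) := by
      ext r
      rw [RingHom.comp_apply, hfx, Algebra.TensorProduct.algebraMap_apply,
        Algebra.algebraMap_eq_smul_one, Algebra.algebraMap_eq_smul_one, TensorProduct.smul_tmul]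
    rw [this]
    exact hpc
  | add t₁ t₂ h₁ h₂ => exact RingHom.IsIntegralElem.add _ h₁ h₂

/-- Every element of `(C_𝔫)^` is integral over `R̂` through `ψ[n]`. [folklore] -/
theorem psi_isIntegralElem (n : MaximalSpectrum C) (d : Cpl[n]) :
    (ψ[n]).IsIntegralElem d := by
  classical
  obtain ⟨b, rfl⟩ : ∃ b : ∀ m : MaximalSpectrum C, Cpl[m], b n = d := ⟨Pi.single n d, by simp⟩
  obtain ⟨t, rfl⟩ := (Stacks07N9_local R C).surjective b
  exact (isIntegralElem_includeRight t).map
    ((Pi.evalRingHom _ n).comp (Stacks07N9_local R C).toRingEquiv.toRingHom)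

/-- **The kernel of `ψ[n] : R̂ → (C_𝔫)^` is a minimal prime of `R̂`**, provided `R ⊆ C` is
birational and all `(C_𝔪)^` are domains. [folklore] -/
theorem ker_psi_mem_minimalPrimes [IsDomain R] [IsDomain C]
    (hinj : Function.Injective (algebraMap R C))
    (hbir : ∀ c : C, ∃ s : R, s ≠ 0 ∧ ∃ a : R, s • c = algebraMap R C a)
    (hdom : ∀ n : MaximalSpectrum C, IsDomain Cpl[n]) (n : MaximalSpectrum C) :
    RingHom.ker ψ[n] ∈ minimalPrimes R̂ := by
  classical
  rw [← RingHom.comap_ker]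
  haveI := hdom n
  refine comap_mem_minimalPrimes_of_birational ψΠ (psiPi_injective hinj)
    (Set.range fun s : {s : R // s ≠ 0} => algebraMap R R̂ s) ?_ ?_
    (ker_evalRingHom_mem_minimalPrimes _ n)
  · rintro _ ⟨⟨s, hs⟩, rfl⟩
    exact psiPi_of_mem_nonZeroDivisors hinj hdom hs
  · intro b
    obtain ⟨s, hs, r, hr⟩ := psiPi_birational hbir b
    exact ⟨_, ⟨⟨s, hs⟩, rfl⟩, r, hr⟩

/-- **Regular analytic branches below force regular local rings above.** Let `R` be a Noetherian
local domain and `C ⊇ R` a domain, module-finite and birational over `R`, whose completed local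
rings `(C_𝔪)^` at maximal ideals are domains. If every analytic branch `R̂ ⧸ P` (`P` a minimal
prime of `R̂`) is a regular local ring, then `C_𝔫` is a regular local ring for every maximal
ideal `𝔫` of `C`. [folklore] -/
theorem isRegularLocalRing_localization_of_branches_regular [IsDomain R] [IsDomain C]
    (hinj : Function.Injective (algebraMap R C))
    (hbir : ∀ c : C, ∃ s : R, s ≠ 0 ∧ ∃ a : R, s • c = algebraMap R C a)
    (hdom : ∀ n : MaximalSpectrum C, IsDomain Cpl[n])
    (hreg : ∀ P ∈ minimalPrimes R̂, IsRegularLocalRing (R̂ ⧸ P))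
    (n : MaximalSpectrum C) : IsRegularLocalRing (Localization.AtPrime n.asIdeal) := by
  classical
  haveI := n.isMaximal
  haveI : IsNoetherianRing C := isNoetherian_of_tower R inferInstance
  haveI := hdom n
  set P : Ideal R̂ := RingHom.ker ψ[n]
  haveI hPreg : IsRegularLocalRing (R̂ ⧸ P) := hreg P (ker_psi_mem_minimalPrimes hinj hbir hdom n)
  haveI : IsDomain (R̂ ⧸ P) := isDomain_of_isRegularLocalRing _
  haveI : IsIntegrallyClosed (R̂ ⧸ P) := isIntegrallyClosed_of_isRegularLocalRing _
  -- `ψ̄ : R̂ ⧸ P → (C_𝔫)^` is injective, integral and birational, hence bijective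
  obtain ⟨ψb, hψb_inj, hψb_mk⟩ : ∃ ψb : R̂ ⧸ P →+* Cpl[n], Function.Injective ψb ∧
      ∀ r, ψb (Ideal.Quotient.mk P r) = ψ[n] r :=
    ⟨RingHom.kerLift _, RingHom.kerLift_injective _, fun r => RingHom.kerLift_mk _ r⟩
  have hcomp : ψb.comp (Ideal.Quotient.mk P) = ψ[n] := RingHom.ext hψb_mk
  have hbij : Function.Bijective ψb := by
    refine bijective_of_isIntegrallyClosed_of_birational ψb hψb_inj ?_ ?_
    · intro d
      obtain ⟨p, hp, hpd⟩ := psi_isIntegralElem (R := R) n d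
      refine ⟨p.map (Ideal.Quotient.mk P), hp.map _, ?_⟩
      rw [Polynomial.eval₂_map, hcomp]
      exact hpd
    · intro d
      obtain ⟨b, rfl⟩ : ∃ b : ∀ m : MaximalSpectrum C, Cpl[m], b n = d := ⟨Pi.single n d, by simp⟩
      obtain ⟨s, hs, r, hr⟩ := psiPi_birational hbir b
      refine ⟨Ideal.Quotient.mk P (algebraMap R R̂ s), Ideal.Quotient.mk P r, ?_, ?_⟩
      · rw [hψb_mk]
        show ψΠ (algebraMap R R̂ s) n ≠ 0
        rw [psiPi_of]
        exact of_algebraMap_ne_zero hinj hs n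
      · have h := congrFun hr n
        rw [Pi.mul_apply] at h
        rw [hψb_mk, hψb_mk]
        exact h
  haveI : IsRegularLocalRing Cpl[n] :=
    IsRegularLocalRing.of_ringEquiv (RingEquiv.ofBijective ψb hbij)
  exact IsRegularLocalRing.of_flat_of_isLocalHom (Localization.AtPrime n.asIdeal) Cpl[n]

end Core

end Summit.ResolutionOfSingularities.ResolutionOfSingularities.Theorems.TeissierResolve.RegularBranches

end
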